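import Summits.AtomisticToContinuum.Crystallization.Theorems.ThreeConeCertificateSlackRigidityLayerUnfoldingA
import Mathlib.Algebra.Module.ZLattice.Basic
import Mathlib.MeasureTheory.Group.FundamentalDomain
import HarnessLib

/-!
# Torus-section unfolding of a silent Barlow stacking — the stub `stub_layerUnfolding`
(line `signed-root-silent-field` of crux `SlackRigidity`, stmt-AtomisticToContinuum-11960, lead c2)

**Statement (STUB 5a).**  If the Barlow stacking `barlowStacking a h s` (`a, h > 0`, any `s`) is
SILENT for a continuous kernel `K` with `|K(r)| ≤ C_K (1+r)⁻⁴`, i.e. `Σ_{q ∈ X} K(|y − q|) = 0` for every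
`y ∈ ℝ³`, then for every height `t` the layer phases `ω^{L_k} = rodPhase s k` and the rod profile
`c_G = rodProfile a K` satisfy `Σ_k ω^{L_k} c_G(t − kh) = 0` (as a `HasSum` over `k : ℤ`).

**Proof.**  Part A (`…LayerUnfoldingA`) parametrises the stacking by `ℤ × (ℤ × ℤ)` and reads silence
on the section `x₃ = t`: `Σ_{(k,n)} g_{t−kh}(u − λ_n − c_k) = 0` for all `u ∈ ℝ²`, with the section
kernels `g_c(x) = K(√(|x|² + c²))`, the layer lattice `λ_n = n₁(a,0) + n₂(a/2, a√3/2)` and the letter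
offsets `c_k = L_k (a/2, a√3/6)`.  Here we multiply by the class-1 character `χ(u) = e^{−2πi⟨u,G⟩}`
(`G = rodDual a`) and integrate over the fundamental parallelogram `P` of the layer lattice
(`ZSpan.fundamentalDomain`, `ZSpan.isAddFundamentalDomain'`): the absolute series
`Σ_{(k,n)} ∫_P |g_{t−kh}(u − λ_n − c_k)| du = Σ_k ∫_{ℝ²} |g_{t−kh}|` is finite (part A), so
`Σ_m ∫_P F_m = ∫_P Σ_m F_m = 0` (`integral_tsum`); for each layer `k`, since `χ` is `Λ`-periodic
(`⟨λ_n, G⟩ = n₁ ∈ ℤ`) and `P` is a fundamental domain, `Σ_n ∫_P χ(u) g(u − λ_n − c_k) du =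
∫_{ℝ²} χ(u) g(u − c_k) du = χ(c_k)·∫ χ g = ω^{L_k} c_G(t − kh)` (`⟨c_k, G⟩ = L_k/3`,
`Real.fourier_eq'`); regrouping the absolutely convergent double series layer by layer
(`HasSum.prod_fiberwise`) gives the claim.  The unfolding identity is proved in `HasSum` form for a
general fundamental domain (`hasSum_integral_vadd`).  All `[folklore]` (Poisson summation with a
structure factor: Cohn–Kumar 2006 §9; Conway–Sloane Ch. 4); no definitions are introduced.
-/

noncomputable section

open scoped BigOperators Topology FourierTransform ENNReal Pointwise
open MeasureTheory Filter Set Metric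
open Literature.MathematicalPhysics.StatisticalMechanics
open Summit.AtomisticToContinuum.Crystallization.Theorems.SlackRigidityNegative (E3)
open Summit.AtomisticToContinuum.Crystallization.Theorems.SignedRootSilentField
  (E2 rodDual rodPoint rodProfile rodPhase rodProfile_def rodPhase_def)

namespace Summit.AtomisticToContinuum.Crystallization.Theorems.SignedRootUnfolding

/-! ### Unfolding over a fundamental domain -/

/-- **Unfolding (Bochner, `HasSum` form)**: for an integrable `f` and a fundamental domain `s` of a
countable group `G` of measure-preserving translations, `Σ_{g ∈ G} ∫_s f(g + x) dx = ∫ f`, the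
series converging unconditionally to the integral (Mathlib's `integral_eq_tsum''` upgraded from
`tsum` to `HasSum` via `hasSum_integral_measure`). [folklore] -/
theorem hasSum_integral_vadd {G α E : Type*} [AddGroup G] [AddAction G α] [MeasurableSpace α]
    [NormedAddCommGroup E] [NormedSpace ℝ E] {s : Set α} {μ : Measure α} [MeasurableConstVAdd G α]
    [VAddInvariantMeasure G α μ] [Countable G] (hs : IsAddFundamentalDomain G s μ) {f : α → E}
    (hf : Integrable f μ) :
    HasSum (fun g : G => ∫ x in s, f (g +ᵥ x) ∂μ) (∫ x, f x ∂μ) := by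
  have h1 : HasSum (fun g : G => ∫ x in g +ᵥ s, f x ∂μ)
      (∫ x, f x ∂(Measure.sum fun g : G => μ.restrict (g +ᵥ s))) :=
    hasSum_integral_measure (by rwa [hs.sum_restrict])
  rw [hs.sum_restrict] at h1
  convert h1 using 2 with g
  rw [← (measurePreserving_vadd g μ).setIntegral_image_emb (measurableEmbedding_const_vadd g) f s,
    Set.image_vadd]

/-- **`ℤ × ℤ` parametrises the `ℤ`-span of a basis of the plane**: `n ↦ n₁ b₀ + n₂ b₁` is a
bijection onto `span ℤ {b₀, b₁}`. [folklore] -/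
theorem exists_latticeEquiv (b : Module.Basis (Fin 2) ℝ E2) :
    ∃ e : ℤ × ℤ ≃ ↥(Submodule.span ℤ (Set.range b)).toAddSubgroup,
      ∀ n : ℤ × ℤ, ((e n : ↥(Submodule.span ℤ (Set.range b)).toAddSubgroup) : E2) =
        (n.1 : ℝ) • b 0 + (n.2 : ℝ) • b 1 := by
  have hmem : ∀ n : ℤ × ℤ, (n.1 : ℝ) • b 0 + (n.2 : ℝ) • b 1 ∈
      (Submodule.span ℤ (Set.range b)).toAddSubgroup := by
    intro n
    change _ ∈ Submodule.span ℤ (Set.range b)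
    rw [Submodule.mem_span_range_iff_exists_fun]
    exact ⟨![n.1, n.2], by simp [Fin.sum_univ_two, ← Int.cast_smul_eq_zsmul ℝ]⟩
  have hinj : Function.Injective fun n : ℤ × ℤ => (n.1 : ℝ) • b 0 + (n.2 : ℝ) • b 1 := by
    intro n m hnm
    have hli : LinearIndependent ℝ ![b 0, b 1] := by
      convert b.linearIndependent using 1
      funext i
      fin_cases i <;> rfl
    have h0 : ((n.1 : ℝ) - m.1) • b 0 + ((n.2 : ℝ) - m.2) • b 1 = 0 := by
      simp only at hnm
      calc ((n.1 : ℝ) - m.1) • b 0 + ((n.2 : ℝ) - m.2) • b 1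
          = ((n.1 : ℝ) • b 0 + (n.2 : ℝ) • b 1) - ((m.1 : ℝ) • b 0 + (m.2 : ℝ) • b 1) := by
            rw [sub_smul, sub_smul]; abel
        _ = 0 := by rw [hnm, sub_self]
    obtain ⟨h1, h2⟩ := LinearIndependent.pair_iff.1 hli _ _ h0
    exact Prod.ext (by exact_mod_cast sub_eq_zero.1 h1) (by exact_mod_cast sub_eq_zero.1 h2)
  have hsurj : ∀ g : E2, g ∈ (Submodule.span ℤ (Set.range b)).toAddSubgroup →
      ∃ n : ℤ × ℤ, (n.1 : ℝ) • b 0 + (n.2 : ℝ) • b 1 = g := by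
    intro g hg
    change g ∈ Submodule.span ℤ (Set.range b) at hg
    rw [Submodule.mem_span_range_iff_exists_fun] at hg
    obtain ⟨c, hc⟩ := hg
    refine ⟨(c 0, c 1), ?_⟩
    rw [← hc]
    simp [Fin.sum_univ_two, ← Int.cast_smul_eq_zsmul ℝ]
  refine ⟨Equiv.ofBijective (fun n => ⟨(n.1 : ℝ) • b 0 + (n.2 : ℝ) • b 1, hmem n⟩)
    ⟨fun n m hnm => hinj (congrArg Subtype.val hnm), fun ⟨g, hg⟩ => ?_⟩, fun n => rfl⟩
  obtain ⟨n, rfl⟩ := hsurj g hg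
  exact ⟨n, rfl⟩

/-- **Unfolding of a planar lattice over its fundamental parallelogram** (Bochner and Lebesgue):
for the lattice `Λ = ℤ b₀ ⊕ ℤ b₁` of a basis `b` and `P = ZSpan.fundamentalDomain b`,
`Σ_{n ∈ ℤ²} ∫_P f(x − n₁b₀ − n₂b₁) dx = ∫_{ℝ²} f` for integrable `f` (as a `HasSum`), and the same for
`∫⁻` of any `Φ ≥ 0`. [folklore] -/
theorem unfolding_basis (b : Module.Basis (Fin 2) ℝ E2) :
    (∀ f : E2 → ℂ, Integrable f → HasSum (fun n : ℤ × ℤ =>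
        ∫ x in ZSpan.fundamentalDomain b, f (x - ((n.1 : ℝ) • b 0 + (n.2 : ℝ) • b 1))) (∫ x, f x)) ∧
    (∀ Φ : E2 → ℝ≥0∞, ∫⁻ x, Φ x = ∑' n : ℤ × ℤ,
        ∫⁻ x in ZSpan.fundamentalDomain b, Φ (x - ((n.1 : ℝ) • b 0 + (n.2 : ℝ) • b 1))) := by
  haveI : Countable ↥(Submodule.span ℤ (Set.range b)).toAddSubgroup := by
    change Countable (Submodule.span ℤ (Set.range b))
    infer_instance
  have hP := ZSpan.isAddFundamentalDomain' b (volume : Measure E2)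
  obtain ⟨e, he⟩ := exists_latticeEquiv b
  have hvadd : ∀ (n : ℤ × ℤ) (x : E2),
      ((Equiv.neg (ℤ × ℤ)).trans e) n +ᵥ x = x - ((n.1 : ℝ) • b 0 + (n.2 : ℝ) • b 1) := by
    intro n x
    rw [AddSubgroup.vadd_def, vadd_eq_add, Equiv.coe_trans, Function.comp_apply, Equiv.neg_apply,
      he, Prod.fst_neg, Prod.snd_neg, Int.cast_neg, Int.cast_neg, neg_smul, neg_smul]
    abel
  refine ⟨fun f hf => ?_, fun Φ => ?_⟩
  · have h := hasSum_integral_vadd hP hf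
    rw [← ((Equiv.neg (ℤ × ℤ)).trans e).hasSum_iff] at h
    have key : (fun n : ℤ × ℤ =>
        ∫ x in ZSpan.fundamentalDomain b, f (x - ((n.1 : ℝ) • b 0 + (n.2 : ℝ) • b 1))) =
        (fun g : ↥(Submodule.span ℤ (Set.range b)).toAddSubgroup =>
          ∫ x in ZSpan.fundamentalDomain b, f (g +ᵥ x)) ∘ ((Equiv.neg (ℤ × ℤ)).trans e) := by
      funext n
      simp only [Function.comp_apply, hvadd]
    rw [key]
    exact h
  · rw [hP.lintegral_eq_tsum'' Φ, ← ((Equiv.neg (ℤ × ℤ)).trans e).tsum_eq]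
    simp only [hvadd]

/-- **The fundamental parallelogram of the layer lattice**: there is a set `P ⊆ ℝ²` over which the
layer lattice `λ_n = (a(n₁ + n₂/2), (a√3/2) n₂)` (`a ≠ 0`) unfolds, for Bochner integrals of
integrable functions (`HasSum`) and for Lebesgue integrals of nonnegative functions. [folklore] -/
theorem exists_cell {a : ℝ} (ha : a ≠ 0) {lat : ℤ × ℤ → E2}
    (hlat : ∀ n : ℤ × ℤ, lat n = !₂[a * (n.1 + n.2 / 2), a * Real.sqrt 3 / 2 * n.2]) :
    ∃ P : Set E2,
      (∀ f : E2 → ℂ, Integrable f →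
        HasSum (fun n : ℤ × ℤ => ∫ x in P, f (x - lat n)) (∫ x, f x)) ∧
      (∀ Φ : E2 → ℝ≥0∞, ∫⁻ x, Φ x = ∑' n : ℤ × ℤ, ∫⁻ x in P, Φ (x - lat n)) := by
  -- the layer basis `(a, 0), (a/2, a√3/2)`
  have hli : LinearIndependent ℝ ![(!₂[a, 0] : E2), !₂[a / 2, a * Real.sqrt 3 / 2]] := by
    rw [LinearIndependent.pair_iff]
    intro p q hpq
    have e0 := congrArg (fun x : E2 => x 0) hpq
    have e1 := congrArg (fun x : E2 => x 1) hpq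
    simp only [WithLp.ofLp_add, WithLp.ofLp_smul, WithLp.ofLp_zero, Pi.add_apply, Pi.smul_apply,
      Pi.zero_apply, smul_eq_mul, Matrix.cons_val_zero, Matrix.cons_val_one,
      Matrix.cons_val_fin_one] at e0 e1
    have h3 : (0 : ℝ) < Real.sqrt 3 := by positivity
    have hq : q = 0 := by
      have h' : q * (a * Real.sqrt 3) = 0 := by linarith
      rcases mul_eq_zero.1 h' with h0 | h0
      · exact h0
      · exact absurd h0 (mul_ne_zero ha h3.ne')
    subst hq
    have hp : p = 0 := by
      have h' : p * a = 0 := by linarith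
      rcases mul_eq_zero.1 h' with h0 | h0
      · exact h0
      · exact absurd h0 ha
    exact ⟨hp, rfl⟩
  set b : Module.Basis (Fin 2) ℝ E2 := basisOfLinearIndependentOfCardEqFinrank hli (by simp) with hb
  have hb0 : b 0 = !₂[a, 0] := by
    rw [hb, coe_basisOfLinearIndependentOfCardEqFinrank]; rfl
  have hb1 : b 1 = !₂[a / 2, a * Real.sqrt 3 / 2] := by
    rw [hb, coe_basisOfLinearIndependentOfCardEqFinrank]; rfl
  have hlat' : ∀ n : ℤ × ℤ, (n.1 : ℝ) • b 0 + (n.2 : ℝ) • b 1 = lat n := by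
    intro n
    rw [hb0, hb1, hlat]
    ext i
    fin_cases i <;> simp <;> ring
  obtain ⟨h1, h2⟩ := unfolding_basis b
  refine ⟨ZSpan.fundamentalDomain b, fun f hf => ?_, fun Φ => ?_⟩
  · simpa only [hlat'] using h1 f hf
  · simpa only [hlat'] using h2 Φ

/-! ### The per-layer identity -/

/-- **The shifted section kernel against the character**:
`∫ χ(u) g_c(u − c_k) du = ω^{L_k} · c_G(c)` with `c_G = rodProfile a K` (substitute `u = v + c_k`,
`χ(v + c_k) = ω^{L_k} χ(v)`, `Real.fourier_eq'`). [folklore] -/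
theorem integral_chi_mul_shift {a : ℝ} (ha : a ≠ 0) (K : ℝ → ℝ) (s : ℤ → ℤ) {χ : E2 → ℂ}
    {g : ℝ → E2 → ℂ} {off : ℤ → E2}
    (hχ : ∀ u : E2, χ u = Complex.exp (↑(-2 * Real.pi * inner ℝ u (rodDual a)) * Complex.I))
    (hg : ∀ (c : ℝ) (x : E2), g c x = ((K (Real.sqrt (‖x‖ ^ 2 + c ^ 2)) : ℝ) : ℂ))
    (hoff : ∀ k : ℤ, off k = !₂[a * (haggLabel s k / 2), a * Real.sqrt 3 / 2 * (haggLabel s k / 3)])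
    (k : ℤ) (c : ℝ) :
    ∫ u : E2, χ u * g c (u - off k) = rodPhase s k * rodProfile a K c := by
  have h1 := integral_add_right_eq_self (μ := (volume : Measure E2))
    (fun u : E2 => χ u * g c (u - off k)) (off k)
  rw [← h1]
  simp only [add_sub_cancel_right, chi_add_off ha s hχ hoff, mul_assoc]
  rw [integral_const_mul, rodProfile_def, Real.fourier_eq']
  congr 1
  refine integral_congr_ae (Eventually.of_forall fun v => ?_)
  simp only [hχ, hg, smul_eq_mul]

/-- Integrability of `u ↦ χ(u) g_c(u − p)`. [folklore] -/
theorem integrable_chi_mul_sub {a CK : ℝ} {K : ℝ → ℝ} (hKc : Continuous K)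
    (hK : ∀ r : ℝ, 0 ≤ r → |K r| ≤ CK / (1 + r) ^ 4) {χ : E2 → ℂ} {g : ℝ → E2 → ℂ}
    (hχ : ∀ u : E2, χ u = Complex.exp (↑(-2 * Real.pi * inner ℝ u (rodDual a)) * Complex.I))
    (hg : ∀ (c : ℝ) (x : E2), g c x = ((K (Real.sqrt (‖x‖ ^ 2 + c ^ 2)) : ℝ) : ℂ))
    (c : ℝ) (p : E2) : Integrable fun u : E2 => χ u * g c (u - p) := by
  refine ((integrable_sectionKernel hKc hK hg c).comp_sub_right p).bdd_mul (c := 1)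
    (continuous_chi hχ).aestronglyMeasurable (Eventually.of_forall fun u => ?_)
  rw [hχ]
  exact (Complex.norm_exp_ofReal_mul_I _).le

/-- **Per-layer unfolding**: if `P` unfolds the layer lattice, then for layer `k` (and any phase
constant `c`), `Σ_{n ∈ ℤ²} ∫_P χ(u) g_c(u − (λ_n + c_k)) du = ω^{L_k} c_G(c)`. [folklore] -/
theorem hasSum_layer {a CK : ℝ} (ha : a ≠ 0) {K : ℝ → ℝ} (hKc : Continuous K)
    (hK : ∀ r : ℝ, 0 ≤ r → |K r| ≤ CK / (1 + r) ^ 4) (s : ℤ → ℤ) {χ : E2 → ℂ} {g : ℝ → E2 → ℂ}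
    {lat : ℤ × ℤ → E2} {off : ℤ → E2}
    (hχ : ∀ u : E2, χ u = Complex.exp (↑(-2 * Real.pi * inner ℝ u (rodDual a)) * Complex.I))
    (hg : ∀ (c : ℝ) (x : E2), g c x = ((K (Real.sqrt (‖x‖ ^ 2 + c ^ 2)) : ℝ) : ℂ))
    (hlat : ∀ n : ℤ × ℤ, lat n = !₂[a * (n.1 + n.2 / 2), a * Real.sqrt 3 / 2 * n.2])
    (hoff : ∀ k : ℤ, off k = !₂[a * (haggLabel s k / 2), a * Real.sqrt 3 / 2 * (haggLabel s k / 3)])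
    {P : Set E2}
    (hP : ∀ f : E2 → ℂ, Integrable f → HasSum (fun n : ℤ × ℤ => ∫ x in P, f (x - lat n)) (∫ x, f x))
    (k : ℤ) (c : ℝ) :
    HasSum (fun n : ℤ × ℤ => ∫ u in P, χ u * g c (u - (lat n + off k)))
      (rodPhase s k * rodProfile a K c) := by
  have h1 := hP _ (integrable_chi_mul_sub (a := a) hKc hK hχ hg c (off k))
  rw [integral_chi_mul_shift ha K s hχ hg hoff k c] at h1
  convert h1 using 3 with n
  funext u
  rw [chi_sub_lat ha hχ hlat, sub_sub]

/-! ### The registered stub -/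

/-- **STUB 5a (`stub_layerUnfolding`) — TORUS-SECTION UNFOLDING OF A SILENT BARLOW STACKING.**
If the Barlow stacking `barlowStacking a h s` (`a, h > 0`, any `s`) is silent for a continuous kernel
`|K(r)| ≤ C_K(1+r)⁻⁴`, then for every height `t` the layer phases `ω^{L_k} = rodPhase s k` and the rod
profile `c_G = rodProfile a K` satisfy the 1-D identity `Σ_k ω^{L_k} c_G(t − kh) = 0`.
Proof: parametrise the stacking by `(k, (i, j)) ↦ barlowPos a h s k i j`; on the section `y = (u, t)`
silence says `Σ_m g_{t−kh}(u − λ_n − c_k) = 0`; multiply by `χ(u) = e^{−2πi⟨u,G⟩}` and integrate over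
the fundamental parallelogram `P` of the layer lattice — the absolute series is finite
(`tsum_lintegral_enorm_sectionKernel_lt_top` unfolded over `P`), so `Σ_m ∫_P F_m = ∫_P Σ_m F_m = 0`;
layer `k` unfolds (`hasSum_layer`) to `ω^{L_k} c_G(t − kh)`; regroup fibrewise
(`HasSum.prod_fiberwise`). [folklore] -/
theorem stub_layerUnfolding :
  ∀ (a h CK : ℝ), 0 < a → 0 < h → ∀ K : ℝ → ℝ, Continuous K →
    (∀ r : ℝ, 0 ≤ r → |K r| ≤ CK / (1 + r) ^ 4) →
    ∀ s : ℤ → ℤ,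
      (∀ y : E3, HasSum (fun q : ↥(barlowStacking a h s) => K ‖y - (q : E3)‖) 0) →
      ∀ t : ℝ, HasSum (fun k : ℤ => rodPhase s k * rodProfile a K (t - k * h)) 0 := by
  intro a h CK ha hh K hKc hK s hsil t
  -- the objects: character, section kernels, layer lattice, letter offsets
  set χ : E2 → ℂ := fun u => Complex.exp (↑(-2 * Real.pi * inner ℝ u (rodDual a)) * Complex.I)
    with hχdef
  have hχ : ∀ u : E2, χ u = Complex.exp (↑(-2 * Real.pi * inner ℝ u (rodDual a)) * Complex.I) :=
    fun u => rfl
  set g : ℝ → E2 → ℂ := fun c x => ((K (Real.sqrt (‖x‖ ^ 2 + c ^ 2)) : ℝ) : ℂ) with hgdef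
  have hg : ∀ (c : ℝ) (x : E2), g c x = ((K (Real.sqrt (‖x‖ ^ 2 + c ^ 2)) : ℝ) : ℂ) :=
    fun c x => rfl
  set lat : ℤ × ℤ → E2 := fun n => !₂[a * (n.1 + n.2 / 2), a * Real.sqrt 3 / 2 * n.2] with hlatdef
  have hlat : ∀ n : ℤ × ℤ, lat n = !₂[a * (n.1 + n.2 / 2), a * Real.sqrt 3 / 2 * n.2] :=
    fun n => rfl
  set off : ℤ → E2 := fun k => !₂[a * (haggLabel s k / 2), a * Real.sqrt 3 / 2 * (haggLabel s k / 3)]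
    with hoffdef
  have hoff : ∀ k : ℤ, off k =
      !₂[a * (haggLabel s k / 2), a * Real.sqrt 3 / 2 * (haggLabel s k / 3)] := fun k => rfl
  -- the fundamental parallelogram of the layer lattice
  obtain ⟨P, hP, hPl⟩ := exists_cell ha.ne' hlat
  -- the integrand family `F_{(k,n)}(u) = χ(u) g_{t−kh}(u − λ_n − c_k)`
  set F : ℤ × (ℤ × ℤ) → E2 → ℂ := fun m u => χ u * g (t - m.1 * h) (u - (lat m.2 + off m.1))
    with hFdef
  -- pointwise: `Σ_m F_m(u) = 0` (silence on the section)
  have hpt : ∀ u : E2, HasSum (fun m => F m u) 0 := by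
    intro u
    have h1 := hasSum_section ha hh hlat hoff hsil t u
    have h2 : HasSum (fun m : ℤ × (ℤ × ℤ) =>
        ((K (Real.sqrt (‖u - (lat m.2 + off m.1)‖ ^ 2 + (t - m.1 * h) ^ 2)) : ℝ) : ℂ))
        ((0 : ℝ) : ℂ) :=
      Complex.hasSum_ofReal.mpr h1
    have h3 := h2.mul_left (χ u)
    rw [Complex.ofReal_zero, mul_zero] at h3
    exact h3
  -- measurability of each term on the cell
  have hmeas : ∀ m, AEStronglyMeasurable (F m) (volume.restrict P) := by
    intro m
    refine (Continuous.aestronglyMeasurable ?_).restrict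
    exact (continuous_chi hχ).mul
      ((continuous_sectionKernel hKc hg _).comp (continuous_id.sub continuous_const))
  -- the absolute series is finite: unfold layer by layer and use the decay split
  have hfin : ∑' m, ∫⁻ u in P, ‖F m u‖ₑ ≠ ∞ := by
    have hk : ∀ k : ℤ, ∑' n : ℤ × ℤ, ∫⁻ u in P, ‖F (k, n) u‖ₑ = ∫⁻ x : E2, ‖g (t - k * h) x‖ₑ := by
      intro k
      have hre : ∀ (n : ℤ × ℤ) (u : E2), ‖F (k, n) u‖ₑ =
          (fun x => ‖g (t - k * h) (x - off k)‖ₑ) (u - lat n) := by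
        intro n u
        simp only [hFdef, enorm_mul, enorm_chi hχ, one_mul, sub_sub]
      simp only [hre]
      rw [← hPl (fun x => ‖g (t - k * h) (x - off k)‖ₑ)]
      exact lintegral_sub_right_eq_self (fun y => ‖g (t - k * h) y‖ₑ) _
    rw [ENNReal.tsum_prod']
    simp only [hk]
    exact (tsum_lintegral_enorm_sectionKernel_lt_top hK hg t hh).ne
  -- interchange: the series of the cell integrals vanishes …
  have htsum : ∑' m, ∫ u in P, F m u = 0 := by
    rw [← integral_tsum hmeas hfin]
    have : (fun u => ∑' m, F m u) = fun _ => 0 := funext fun u => (hpt u).tsum_eq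
    rw [this, integral_zero]
  -- … and is summable
  have hsum : Summable fun m => ∫ u in P, F m u := by
    refine Summable.of_norm_bounded (ENNReal.summable_toReal hfin) fun m => ?_
    have := norm_integral_le_lintegral_norm (μ := volume.restrict P) (F m)
    simpa only [ofReal_norm] using this
  have hHas : HasSum (fun m => ∫ u in P, F m u) 0 := htsum ▸ hsum.hasSum
  -- regroup layer by layer
  exact hHas.prod_fiberwise fun k => hasSum_layer ha.ne' hKc hK s hχ hg hlat hoff hP k (t - k * h)

end Summit.AtomisticToContinuum.Crystallization.Theorems.SignedRootUnfolding

end
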